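import Summits.HubbardSuperconductivity.HubbardSuperconductivity.Theorems.KacWindowPenaltyWindowGapPenalisedForms
import Summits.HubbardSuperconductivity.HubbardSuperconductivity.Theorems.TwTipContinuation.Negative.TipNormalForm
import Summits.HubbardSuperconductivity.HubbardSuperconductivity.Theses.DeformationLadder
import Literature.MathematicalPhysics.QuantumLattice.GriffithsLemmaGroundStates

/-!
# Crux `WindowGap` (stmt-HubbardSuperconductivity-1088) — strategist census, TYPED attempts

Companion of `Cruxes/WindowGap/STRATEGY-CENSUS.md` (wall-breaker seat
planner-cstrat-stmt-HubbardSuperconductivity-1088-p1-0, 2026-08-17). Every `def … : Prop` below is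
one of the census attempts (Strengthen / Decomposition) stated over existing declarations; the two
theorems are the glue facts the census relies on:

* `windowGap_of_minimiserLRO_robust` — the ONLY typed split of the crux with provable glue:
  (every sector minimiser of the pure torus has d-wave LRO at some (U,δ)) ∧ (robustness of that
  floor under a weak Kac-window repulsion) → `WindowGap` (via the landed `windowGap_of_penalisedLRO`);
* `summit_of_somePointMinimiserLRO` — but its first piece ALONE already proves the summit statement
  (via the landed `summitMatrix_of_everyGSOrder`): the split is not "short of the summit".

No `sorry`; nothing here is a line (see the census for why).
-/

set_option linter.dupNamespace false

namespace Summit.HubbardSuperconductivity.HubbardSuperconductivity.Cruxes.WindowGap.Strategist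

open Matrix Literature.MathematicalPhysics.QuantumLattice
open Summit.HubbardSuperconductivity.HubbardSuperconductivity.Theses.KacWindowPenalty (WindowGap)
open Summit.HubbardSuperconductivity.HubbardSuperconductivity.Theorems

noncomputable section

/-- The crux's literal Kac-window pair penalty `W_ε = L⁻² Σ_{|q_m| ≤ ε} Δ_d(m)ᴴ Δ_d(m)`. -/
def kacW (L : ℕ) [NeZero L] (ε : ℝ) :
    Matrix (Finset (Orb (FermionTorus 2 L))) (Finset (Orb (FermionTorus 2 L))) ℂ :=
  ∑ m : Fin 2 → ZMod L,
    if (2 * Real.pi / (L : ℝ)) ^ 2 * (∑ i : Fin 2, (((m i).valMinAbs : ℤ) : ℝ) ^ 2) ≤ ε ^ 2 then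
      ((L : ℂ) ^ 2)⁻¹ • (Matrix.conjTranspose (pairFieldAt dWaveFormFactor L m) *
        pairFieldAt dWaveFormFactor L m)
    else 0

/-- The summit filling `N_L = 2⌊(1−δ)L²/2⌋`. -/
def Nfill (δ : ℝ) (L : ℕ) : ℕ := 2 * ⌊(1 - δ) * (L : ℝ) ^ 2 / 2⌋₊

/-! ## Strengthen -/

/-- **S2 — linear deficit pricing (the Correggi–Giuliani–Seiringer shape).** At some `(U,δ)` the
energy above the sector ground energy is bounded BELOW, linearly, by `c ε²` times the deficit of
window pair weight from a floor `M L²`, uniformly in even `L`, for every small `ε`. This is the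
ferromagnet's `H_ℓ ≥ C (S/ℓ²)(Sℓ³ − S_T)` (arXiv:1312.7873 Prop. 5.2) transcribed with
`ℓ ↦ 1/ε`, `S_max − S_T ↦ M L² − ⟨W_ε⟩`. It implies the crux's depletion-cost normal form
(`windowGap_of_depletionCost`) with `c(ε) = c ε² a`; the census explains why it is FALSE-in-kind for a
superconductor (amplitude mode: uniform suppression by a fraction `f` costs `O(f²)`, deficit `O(f)`). -/
def LinearDeficitPricing : Prop :=
  ∃ U : ℝ, 0 < U ∧ ∃ δ ∈ Set.Ioo (0 : ℝ) (1 / 2), ∃ c M ε₁ : ℝ, 0 < c ∧ 0 < M ∧ 0 < ε₁ ∧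
    ∀ ε ∈ Set.Ioc (0 : ℝ) ε₁, ∃ L₀ : ℕ, ∀ (L : ℕ) [NeZero L], L₀ ≤ L → Even L →
      ∀ φ : Fock (Orb (FermionTorus 2 L)), φ ∈ szSector (Nfill δ L) 0 → star φ ⬝ᵥ φ = 1 →
        c * ε ^ 2 * (M * (L : ℝ) ^ 2 - (star φ ⬝ᵥ kacW L ε *ᵥ φ).re) ≤
          (star φ ⬝ᵥ hubbardTorus 2 L 1 U *ᵥ φ).re -
            (hubbardTorus 2 L 1 U).minEnergyOn (szSector (Nfill δ L) 0)

/-- Sector projection matrix (orthogonal projection onto `K`, as a matrix). -/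
def sectorProjM {n : Type*} [Fintype n] [DecidableEq n] (K : Submodule ℂ (n → ℂ)) : Matrix n n ℂ :=
  projMatrix (K.map ((WithLp.linearEquiv 2 ℂ (n → ℂ)).symm : (n → ℂ) →ₗ[ℂ] _))

/-- Sector (canonical) free energy `F_β(H | K) = −β⁻¹ log tr (P_K e^{−βH})` (meaningful for Hermitian
`H` commuting with `P_K`, `K ≠ ⊥`, `β > 0`). -/
def sectorFreeEnergy {n : Type*} [Fintype n] [DecidableEq n] (β : ℝ) (H : Matrix n n ℂ)
    (K : Submodule ℂ (n → ℂ)) : ℝ :=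
  -(1 / β) * Real.log ((sectorProjM K * gibbsWeight β H).trace).re

/-- **S3 — positive-temperature strengthening.** The crux with ground energies replaced by sector
free energies at an inverse temperature `β` chosen after `(ε, λ, a)`, with the entropy slack
`L² log 4 / β` added to the margin. By `ThermalBridge` it implies `WindowGap`; the census shows it is
crux-EQUIVALENT up to that slack once `β ≥ 2 log 4/(λ a)` (so it is a dress, not a strengthening with
an engine: the needed temperature `T ≍ λ a ≍ ε²` lies below the BCS/BKT scales). -/
def ThermalWindowGap : Prop :=
  ∃ U : ℝ, 0 < U ∧ ∃ δ ∈ Set.Ioo (0 : ℝ) (1 / 2), ∀ C : ℝ, 0 ≤ C → ∀ ε₀ : ℝ, 0 < ε₀ →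
    ∃ ε ∈ Set.Ioc (0 : ℝ) ε₀, ∃ lam a β : ℝ, 0 < lam ∧ 0 < a ∧ 0 < β ∧ ∃ L₀ : ℕ,
      ∀ (L : ℕ) [NeZero L], L₀ ≤ L → Even L →
        lam * (C * ε + a) * (L : ℝ) ^ 2 + (L : ℝ) ^ 2 * Real.log 4 / β ≤
          sectorFreeEnergy β (hubbardTorus 2 L 1 U + (lam : ℂ) • kacW L ε) (szSector (Nfill δ L) 0) -
            sectorFreeEnergy β (hubbardTorus 2 L 1 U) (szSector (Nfill δ L) 0)

/-- **Thermal bridge (provable support, finite-dimensional):** for the two sector-preserving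
Hermitian matrices of the crux, `minE(H|K) − L² log 4/β ≤ F_β(H|K) ≤ minE(H|K)` (Gibbs variational
principle; `dim K ≤ 4^{L²}`). With it `ThermalWindowGap → WindowGap` is three lines of arithmetic. -/
def ThermalBridge : Prop :=
  ∀ (U lam ε β : ℝ), 0 ≤ lam → 0 < β → ∀ (N : ℕ) (L : ℕ) [NeZero L], 2 ≤ L → N ≤ 2 * L ^ 2 →
    let K := szSector (Λ := FermionTorus 2 L) N 0
    let H := hubbardTorus 2 L 1 U + (lam : ℂ) • kacW L ε
    H.minEnergyOn K - (L : ℝ) ^ 2 * Real.log 4 / β ≤ sectorFreeEnergy β H K ∧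
      sectorFreeEnergy β H K ≤ H.minEnergyOn K

/-! ## Decomposition -/

/-- Every unit sector MINIMISER of the pure torus at `(U,δ)` has d-wave LRO density `≥ l₀`,
eventually in even `L` (minimiser form of "every ground state has LRO"). -/
def MinimiserLRO (U δ l₀ : ℝ) : Prop :=
  ∃ L₀ : ℕ, ∀ (L : ℕ) [NeZero L], L₀ ≤ L → Even L →
    ∀ ψ : Fock (Orb (FermionTorus 2 L)), ψ ∈ szSector (Nfill δ L) 0 → star ψ ⬝ᵥ ψ = 1 →
      (star ψ ⬝ᵥ hubbardTorus 2 L 1 U *ᵥ ψ).re =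
        (hubbardTorus 2 L 1 U).minEnergyOn (szSector (Nfill δ L) 0) →
      l₀ * (L : ℝ) ^ 4 ≤ (expect ((pairField dWaveFormFactor L)ᴴ * pairField dWaveFormFactor L) ψ).re

/-- For every window radius some penalty strength keeps the floor `l₀` in every unit sector
minimiser of the PENALISED torus (verbatim the hypothesis shape of `windowGap_of_penalisedLRO`). -/
def PenalisedMinimiserLRO (U δ l₀ : ℝ) : Prop :=
  ∀ ε : ℝ, 0 < ε → ∃ lam : ℝ, 0 < lam ∧ ∃ L₀ : ℕ, ∀ (L : ℕ) [NeZero L], L₀ ≤ L → Even L →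
    ∀ ψ : Fock (Orb (FermionTorus 2 L)), ψ ∈ szSector (2 * ⌊(1 - δ) * (L : ℝ) ^ 2 / 2⌋₊) 0 →
      star ψ ⬝ᵥ ψ = 1 →
      (star ψ ⬝ᵥ (hubbardTorus 2 L 1 U + (lam : ℂ) • (∑ m : Fin 2 → ZMod L,
          if (2 * Real.pi / (L : ℝ)) ^ 2 * (∑ i : Fin 2, (((m i).valMinAbs : ℤ) : ℝ) ^ 2) ≤ ε ^ 2
          then ((L : ℂ) ^ 2)⁻¹ • (Matrix.conjTranspose (pairFieldAt dWaveFormFactor L m) *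
            pairFieldAt dWaveFormFactor L m)
          else 0)) *ᵥ ψ).re =
        (hubbardTorus 2 L 1 U + (lam : ℂ) • (∑ m : Fin 2 → ZMod L,
          if (2 * Real.pi / (L : ℝ)) ^ 2 * (∑ i : Fin 2, (((m i).valMinAbs : ℤ) : ℝ) ^ 2) ≤ ε ^ 2
          then ((L : ℂ) ^ 2)⁻¹ • (Matrix.conjTranspose (pairFieldAt dWaveFormFactor L m) *
            pairFieldAt dWaveFormFactor L m)
          else 0)).minEnergyOn (szSector (2 * ⌊(1 - δ) * (L : ℝ) ^ 2 / 2⌋₊) 0) →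
      l₀ * (L : ℝ) ^ 4 ≤ (expect ((pairField dWaveFormFactor L)ᴴ * pairField dWaveFormFactor L) ψ).re

/-- **Piece 1 of the split:** at some `(U,δ)` every sector minimiser of the PURE torus has d-wave LRO. -/
def SomePointMinimiserLRO : Prop :=
  ∃ U : ℝ, 0 < U ∧ ∃ δ ∈ Set.Ioo (0 : ℝ) (1 / 2), ∃ l₀ : ℝ, 0 < l₀ ∧ MinimiserLRO U δ l₀

/-- **Piece 2 of the split (window robustness of the order floor = the stiffness content):**
wherever every sector minimiser has LRO `≥ l₀`, a weak enough Kac-window repulsion keeps `≥ l₀/2`. -/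
def WindowRobustness : Prop :=
  ∀ U δ l₀ : ℝ, 0 < U → δ ∈ Set.Ioo (0 : ℝ) (1 / 2) → 0 < l₀ →
    MinimiserLRO U δ l₀ → PenalisedMinimiserLRO U δ (l₀ / 2)

/-- **Glue of the split (kernel-checked): Piece 1 ∧ Piece 2 → crux**, via the landed
`windowGap_of_penalisedLRO` (p98536). -/
theorem windowGap_of_minimiserLRO_robust (h1 : SomePointMinimiserLRO) (h2 : WindowRobustness) :
    WindowGap := by
  obtain ⟨U, hU, δ, hδ, l₀, hl₀, hmin⟩ := h1
  exact windowGap_of_penalisedLRO ⟨U, hU, δ, hδ, l₀ / 2, by positivity, h2 U δ l₀ hU hδ hl₀ hmin⟩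

/-- **Why the split is not short of the summit: Piece 1 ALONE proves the summit statement** (every
sector ground state is a unit minimiser, `re_rayleigh_of_eigen_minEnergyOn`; then the landed
even-side bookkeeping `summitMatrix_of_everyGSOrder`). -/
theorem summit_of_somePointMinimiserLRO (h1 : SomePointMinimiserLRO) :
    _root_.HubbardSuperconductivity := by
  obtain ⟨U, hU, δ, hδ, l₀, hl₀, L₀, hmin⟩ := h1
  refine ⟨U, hU, δ, hδ,
    Summit.HubbardSuperconductivity.TwTipContinuation.Negative.summitMatrix_of_everyGSOrder
      ⟨l₀, hl₀, L₀, ?_⟩⟩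
  intro L _ hL hEven ψ hψ hGS
  exact hmin L hL hEven ψ hGS.1 hψ
    (re_rayleigh_of_eigen_minEnergyOn (hubbardTorus 2 L 1 U) _ hψ hGS.2.2)

/-- **D-loc — the localisation glue that block pigeonhole cannot supply.** Route DeformationLadder's
open crux `LowEnergyRigidity` (stmt-1892: O(1)-shell rigidity of d-wave LRO on every large even
torus) would have to be promoted to the EXTENSIVE shell of width `≍ ε² L²` at scale `1/ε`; the census
shows the block argument loses the Anderson surface slack `Θ(ℓ) ≫ κ` per block of side `ℓ ≍ 1/ε`.
Typed here only to record the exact implication that remains the whole crux. -/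
def LocalisationGlue : Prop :=
  Summit.HubbardSuperconductivity.HubbardSuperconductivity.Theses.DeformationLadder.LowEnergyRigidity →
    WindowGap

end

end Summit.HubbardSuperconductivity.HubbardSuperconductivity.Cruxes.WindowGap.Strategist
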